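import Summits.BirchSwinnertonDyer.BirchSwinnertonDyer.Theses.TwoAdicConverse
import Summits.BirchSwinnertonDyer.BirchSwinnertonDyer.Theorems.KolyvaginRankRigidityAtTwoNoTwoTorsionOverK
import HarnessLib

/-!
# Route `TwoAdicConverse` (rung S3), split child `NoTwoTorsionOverK` (stmt-BirchSwinnertonDyer-24405)

The S3 split of `RankOneTwoConverse` (RUNBOOK-19220-split) re-states route KolyvaginRankRigidityAtTwo's
support `NoTwoTorsionOverK` VERBATIM as a child of route `TwoAdicConverse`. The statement — `E(K)[2] = 0`
for `K` imaginary quadratic when `ρ̄_{E,2^m}` is onto for all `m` (only `m = 1`, `GL₂(𝔽₂) ≅ S₃`, is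
used) — is the tree theorem `KolyvaginRankRigidity.torsionBy_two_eq_bot_of_hasSurjectiveModNGaloisRep`
(the Gross §2 argument at `p = 2` with an order-`3` element of `GL₂(𝔽₂)` in place of a transvection),
landed with the KRR2 support 23952 (the dedup gate forbids a second, route-independent copy, whence
the import of that module). BSD is not proved by this file.
-/

set_option autoImplicit false
-- the Theorems namespace of this sub repeats the summit name by design (D-0017 nested layout)
set_option linter.dupNamespace false

namespace Summit.BirchSwinnertonDyer.BirchSwinnertonDyer.Theorems.KolyvaginRankRigidity

/-- **Item `NoTwoTorsionOverK` of route `TwoAdicConverse` holds** (verbatim twin of the KRR2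
support 23952; `E(K)[2] = 0` under surjective `ρ̄_{E,2}` for `K` imaginary quadratic). -/
theorem twoAdicConverse_noTwoTorsionOverK_proof :
    Summit.BirchSwinnertonDyer.BirchSwinnertonDyer.Theses.TwoAdicConverse.NoTwoTorsionOverK := by
  unfold Summit.BirchSwinnertonDyer.BirchSwinnertonDyer.Theses.TwoAdicConverse.NoTwoTorsionOverK
  intro W _ hsur K _ _ hK
  have h1 : W.HasSurjectiveModNGaloisRep ((2 ^ 1 : ℕ) : ℤ) := hsur 1
  rw [pow_one] at h1
  exact torsionBy_two_eq_bot_of_hasSurjectiveModNGaloisRep W K hK.1 h1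

end Summit.BirchSwinnertonDyer.BirchSwinnertonDyer.Theorems.KolyvaginRankRigidity
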